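import Summits.BirchSwinnertonDyer.Rank1Residual.GaloisImage.KolyvaginCongruenceAscent
import HarnessLib

/-!
# The descent step of the Kolyvagin congruence (Perrin-Riou, *Systèmes d'Euler p-adiques*,
# Prop. 2.2.5 (ii), end of proof p. 1253: "en appliquant la corestriction") — file C0c of
# THEOREM C of row T-DER (cell `b2b-bsdres`, team n1011, seat p11 GEN 8, OWNERS row T-DER =
# skel/T-DER.md STATUS v8)

HONEST FRAMING (cell `b2b-bsdres`, run/shared/lean/b2b/bsd-rank1-residual/, verbatim in every
file): the goal of the cell is to DELETE the COMBINATION-SHAPED residual classes of the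
Birch–Swinnerton-Dyer formula for ALL analytic-rank `≤ 1` elliptic curves over `ℚ` — "full BSD
formula for every rank `≤ 1` curve in class `C`" assembled STRICTLY from published theorems — so
that the rank-`≤ 1` remainder becomes exactly the CONSTRUCTION-SHAPED classes, which are TYPED
(missing-input `Prop`s), NOT attempted. This is not "finishing BSD". Team n1011: research route on
the CONSTRUCTION-SHAPED class X4 / §I N11 (route-1 PORT, (P-DER)); TOOL theorems of continuous
group cohomology (no definition, no named fact, no `sorry`); curve-free, `p`-free.

## What

The ascent (file C0b) proves the congruence `x'_r(φ) − Z x_r(φ) ∈ (φ − 1)T` for the Euler-system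
cocycles of `p`-LEVEL `r = v_p(q^f − 1) ≥ 1` (the first layer of the `p`-tower containing the
Frobenius `φ` of `λ`), at every Frobenius `φ_j = γ^{-j} φ γ^{j}` of the primes above `q`.  THEOREM C
needs it at `p`-level `0`, where the derivative classes live.  Since `φ ∈ U_r` already, the
`p`-direction norm relation `Cor_{U_0/U_r} x_r = x_0` restricted to `U_r` and evaluated at `φ`
reads `Σ_j γ^j x_r(γ^{-j} φ γ^j) = x_0(φ) + (φ − 1)t` (representatives `γ^j` of `U_0/U_r`), and
summing the level-`r` congruences over the conjugates gives the level-`0` congruence: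
* `exists_sub_eq_sub_one_apply_of_descent` — from the two evaluated norm relations (for `x` and
  `x'`), the level-`r` congruences at all `φ_j` (with the conjugated operators
  `Z_j = γ^{-j} Z γ^{j}`), and `Z φ = φ Z`: `x'_0(φ) − Z x_0(φ) ∈ (φ − 1)T`.
Pure pointwise algebra; the instantiation for Kato's system over `cyclotomicLevelsRat` is file C0d.

References: B. Perrin-Riou, Ann. Inst. Fourier 48 (1998), Prop. 2.2.5 (ii), p. 1253.
-/

noncomputable section

open CategoryTheory Function Finset Field
open Literature.NumberTheory.GaloisRepresentations
open Literature.NumberTheory.EllipticCurves (subgroupConj subgroupConj_apply_coe subgroupConj_one)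

universe u v

namespace Summit.BirchSwinnertonDyer.Rank1Residual.GaloisImage

namespace Congruence

section Descent

variable {R : Type v} [CommRing R] [TopologicalSpace R]
variable {G : Type u} [Group G] [TopologicalSpace G] [IsTopologicalGroup G]
variable (X : TopRep.{u} R G)

omit [TopologicalSpace G] [IsTopologicalGroup G] in
/-- Conjugating `(φ_j − 1) w` back: `γ^j · ((γ^{-j} φ γ^j) w − w) = φ (γ^j w) − γ^j w`. [folklore] -/
theorem rho_apply_rho_conj_sub (γj φ : G) (w : X) :
    X.ρ γj (X.ρ (γj⁻¹ * φ * γj) w - w) = X.ρ φ (X.ρ γj w) - X.ρ γj w := by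
  rw [map_sub, ← ρ_mul_apply, ← mul_assoc, ← mul_assoc, mul_inv_cancel, one_mul, ρ_mul_apply]

/-- **Descent of the congruence along the `p`-tower** ([PerrinRiou1998AIF] Prop. 2.2.5 (ii), end
of proof: "en appliquant la corestriction de `ℚ(μ_{mp^r})` à `ℚ(μ_{mp})`").  Let `U_r ≤ U_0`
(`U_r` normal), `φ ∈ U_r`, representatives `γ^j` (`j < N'`) used in the restricted norm relations
`Σ_{j<N'} γ^j x_r(γ^{-j}φγ^j) = x_0(φ) + (φ−1)t` and the same for `x'` with `t'` (these are
`res ∘ Cor_{U_0/U_r} = Σ_j conj_{γ^j}` evaluated at `φ`), an endomorphism `Z` commuting with `φ`,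
and suppose the level-`r` congruence holds at every conjugate Frobenius:
`x'_r(φ_j) − γ^{-j}Zγ^{j} x_r(φ_j) ∈ (φ_j − 1)X`, `φ_j = γ^{-j}φγ^j`.  Then
`x'_0(φ) − Z x_0(φ) ∈ (φ − 1)X`. [cite: PerrinRiou1998AIF, Prop. 2.2.5 (ii)] -/
theorem exists_sub_eq_sub_one_apply_of_descent {U₀ Ur : Subgroup G} [Ur.Normal]
    (x₀ x₀' : contOneCocycles (subgroupRep X U₀)) (xr xr' : contOneCocycles (subgroupRep X Ur))
    (Z : X →ₗ[R] X) {φ : G} (hφr : φ ∈ Ur) (hφ0 : φ ∈ U₀) (hZφ : ∀ v : X, Z (X.ρ φ v) = X.ρ φ (Z v))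
    (γ : G) (N' : ℕ) (t t' : X)
    (hcor : ∑ j ∈ range N', X.ρ (γ ^ j) (xr.1 (subgroupConj Ur (γ ^ j) ⟨φ, hφr⟩)) =
      x₀.1 ⟨φ, hφ0⟩ + (X.ρ φ t - t))
    (hcor' : ∑ j ∈ range N', X.ρ (γ ^ j) (xr'.1 (subgroupConj Ur (γ ^ j) ⟨φ, hφr⟩)) =
      x₀'.1 ⟨φ, hφ0⟩ + (X.ρ φ t' - t'))
    (hcong : ∀ j ∈ range N', ∃ w : X,
      xr'.1 (subgroupConj Ur (γ ^ j) ⟨φ, hφr⟩) -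
          X.ρ (γ ^ j)⁻¹ (Z (X.ρ (γ ^ j) (xr.1 (subgroupConj Ur (γ ^ j) ⟨φ, hφr⟩)))) =
        X.ρ ((γ ^ j)⁻¹ * φ * γ ^ j) w - w) :
    ∃ w : X, x₀'.1 ⟨φ, hφ0⟩ - Z (x₀.1 ⟨φ, hφ0⟩) = X.ρ φ w - w := by
  have hcong' : ∀ j : ℕ, ∃ w : X, j ∈ range N' →
      xr'.1 (subgroupConj Ur (γ ^ j) ⟨φ, hφr⟩) -
          X.ρ (γ ^ j)⁻¹ (Z (X.ρ (γ ^ j) (xr.1 (subgroupConj Ur (γ ^ j) ⟨φ, hφr⟩)))) =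
        X.ρ ((γ ^ j)⁻¹ * φ * γ ^ j) w - w := fun j => by
    by_cases hj : j ∈ range N'
    · obtain ⟨w, hw⟩ := hcong j hj
      exact ⟨w, fun _ => hw⟩
    · exact ⟨0, fun h => absurd h hj⟩
  choose w hw using hcong'
  -- conjugate each level-`r` congruence back by `γ^j` and sum
  have hj : ∀ j ∈ range N',
      X.ρ (γ ^ j) (xr'.1 (subgroupConj Ur (γ ^ j) ⟨φ, hφr⟩)) -
          Z (X.ρ (γ ^ j) (xr.1 (subgroupConj Ur (γ ^ j) ⟨φ, hφr⟩))) =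
        X.ρ φ (X.ρ (γ ^ j) (w j)) - X.ρ (γ ^ j) (w j) := by
    intro j hjm
    have h := congrArg (X.ρ (γ ^ j)) (hw j hjm)
    rw [map_sub, ρ_apply_ρ_inv_apply, rho_apply_rho_conj_sub] at h
    exact h
  have hsum := sum_congr rfl hj
  rw [sum_sub_distrib, ← map_sum, hcor, hcor', map_add, sum_sub_distrib, ← map_sum, map_sub Z,
    hZφ] at hsum
  -- `hsum : x₀'(φ) + (φ t' − t') − (Z x₀(φ) + (φ Z t − Z t)) = φ W − W`
  refine ⟨∑ j ∈ range N', X.ρ (γ ^ j) (w j) - t' + Z t, ?_⟩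
  rw [map_add, map_sub]
  linear_combination (norm := abel) hsum

end Descent

end Congruence

end Summit.BirchSwinnertonDyer.Rank1Residual.GaloisImage

end
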